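import Literature.NumberTheory.NumberFields.CyclicQuinticField11
import Literature.NumberTheory.NumberFields.PeriodRing241
import HarnessLib

/-!
# The cyclic quintic field of conductor `241`: `K = ℚ(η₀)`, `η₀⁵ + η₀⁴ - 96η₀³ - 212η₀² + 1232η₀ + 512 = 0`

The quintic subfield `K₂₄₁` of `ℚ(ζ₂₄₁)` — the second of the six quintic subfields of the degree-`25`
field `F₅ ⊂ ℚ(ζ₁₁, ζ₂₄₁)` of T. Dokchitser–V. Dokchitser, *A note on the Mordell–Weil rank modulo `n`*,
J. Number Theory 131 (2011), proof of Thm. 2 — made explicit as `K = ℚ[X]/(f)` with `f` the period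
polynomial of conductor `241`, the minimal polynomial of the Gaussian period `η₀ = Σ_{h ∈ H} ζ₂₄₁^h`
(`H ≤ (ℤ/241)ˣ` the fifth powers). Unlike `ℚ(ζ₁₁)⁺` (`CyclicQuinticField11.lean`) this field is NOT
monogenic (`[𝓞 : ℤ[η₀]] = 2⁸·11`); its arithmetic is organised through the period basis
`η₀, …, η₄` and the computable order `PeriodRing241` of the tree. Everything is PROVED:

* `quinticPoly`, `K`, `θ = η₀`: `f` is irreducible (modulo `3`, by the finite quintic criterion of
  `CyclicQuinticField11.lean`), `[K : ℚ] = 5`, `minpoly θ = f`, `N(θ) = -2⁹`.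
* **The five periods in `K`**: `e241 k = P_k(θ)/176` (`e241 0 = θ`) with the explicit quartics `P_k`, and
  **they form a period system** (`isPeriodSystem_e241`: the fifteen products given by the cyclotomic
  numbers of order `5` and `Σ e = -1`, each a polynomial identity modulo `f` closed by
  `linear_combination` with an explicit cubic quotient); hence the ring homomorphism
  `liftK : PeriodRing241 ℤ →+* K`, `ηₖ ↦ e241 k` (universal property).
* **`Gal(K/ℚ) = ⟨σ⟩ ≅ C₅`** with `σ (e241 k) = e241 (k + 1)`: `f(e241 1) = 0` and `176 · e241 (k+1) =
  P_k(e241 1)` are identities IN THE ORDER `PeriodRing241 ℤ` (decided by the kernel) pushed through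
  `liftK`; so the endomorphism `θ ↦ e241 1` is an automorphism of order `5` (`σ`, `σ_e241`,
  `σ_pow_five`), `|Gal(K/ℚ)| = 5`, `IsGalois ℚ K`, every automorphism is a power of `σ`, and
  `N(x) = ∏ σⁱ x`.

What is NOT here (later files): the integral basis `𝓞 = ⊕ ℤ e241 k`, real embeddings, primes and class
number one, units, the `2`-descent.

## References

* T. Dokchitser, V. Dokchitser, J. Number Theory 131 (2011) 1833–1839, proof of Thm. 2.
  [DokchitserDokchitser2011RankModN]
* C. F. Gauss, *Disquisitiones Arithmeticae*, §§343–352; M.-N. Gras, *Non monogénéité de l'anneau des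
  entiers des extensions cycliques de ℚ de degré premier ℓ ≥ 5*, J. Number Theory 23 (1986) 347–353.
  [folklore]
-/

noncomputable section

open Polynomial NumberField

namespace Literature.NumberTheory.NumberFields

namespace CyclicQuintic241

/-! ### The period polynomial `f = X⁵ + X⁴ - 96X³ - 212X² + 1232X + 512` -/

/-- `f = X⁵ + X⁴ - 96X³ - 212X² + 1232X + 512 ∈ ℤ[X]`, the period polynomial of conductor `241`
(the minimal polynomial of the Gaussian period `η₀ = Σ_{h ∈ H} ζ₂₄₁^h`, `H` the fifth powers). [folklore] -/
abbrev quinticPoly : ℤ[X] := X ^ 5 + X ^ 4 - C 96 * X ^ 3 - C 212 * X ^ 2 + C 1232 * X + C 512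

/-- `f ∈ ℚ[X]` (base change of `quinticPoly`). [folklore] -/
abbrev quinticPolyRat : ℚ[X] := quinticPoly.map (algebraMap ℤ ℚ)

/-- `quinticPolyRat = X⁵ + X⁴ - 96X³ - 212X² + 1232X + 512` (numeral coefficients: the `simp` normal form
of the base change). [folklore] -/
theorem quinticPolyRat_eq :
    quinticPolyRat = X ^ 5 + X ^ 4 - 96 * X ^ 3 - 212 * X ^ 2 + 1232 * X + 512 := by
  simp only [quinticPolyRat, quinticPoly, Polynomial.map_add, Polynomial.map_sub,
    Polynomial.map_mul, Polynomial.map_pow, map_X, eq_intCast, Int.cast_ofNat]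
  norm_num

/-- `f` is monic. [folklore] -/
theorem quinticPoly_monic : quinticPoly.Monic := by
  unfold quinticPoly
  monicity!

/-- `deg f = 5`. [folklore] -/
theorem quinticPoly_natDegree : quinticPoly.natDegree = 5 := by
  unfold quinticPoly
  compute_degree!

/-- `f mod 3` in the normal form of `irreducible_quintic_of_forall`. [folklore] -/
theorem quinticPoly_map_three :
    quinticPoly.map (Int.castRingHom (ZMod 3)) =
      X ^ 5 + C (1 : ZMod 3) * X ^ 4 + C (-96 : ZMod 3) * X ^ 3 + C (-212 : ZMod 3) * X ^ 2 +
        C (1232 : ZMod 3) * X + C (512 : ZMod 3) := by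
  ext n
  simp only [quinticPoly, Polynomial.coeff_map, Int.coe_castRingHom, coeff_add, coeff_sub,
    coeff_C_mul, coeff_X_pow, coeff_X, coeff_C, Int.cast_add, Int.cast_sub, Int.cast_mul,
    Int.cast_ite, Int.cast_one, Int.cast_zero, Int.cast_ofNat]
  rcases n with _ | _ | _ | _ | _ | _ | n
  iterate 6 · norm_num
  · simp

/-- **`f` is irreducible modulo `3`** (no root in `𝔽₃` and no quadratic factor over `𝔽₃`, by the finite
criterion `irreducible_quintic_of_forall`): `3` is inert in `K₂₄₁`. [folklore] -/
theorem irreducible_map_zmod_three : Irreducible (quinticPoly.map (Int.castRingHom (ZMod 3))) := by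
  rw [quinticPoly_map_three]
  exact irreducible_quintic_of_forall (F := ZMod 3) _ _ _ _ _ (by decide +kernel) (by decide +kernel)

/-- `f` is irreducible over `ℤ` (it is irreducible modulo `3`). [folklore] -/
theorem quinticPoly_irreducible : Irreducible quinticPoly :=
  Monic.irreducible_of_irreducible_map (Int.castRingHom (ZMod 3)) _ quinticPoly_monic
    irreducible_map_zmod_three

/-- `f` is irreducible over `ℚ` (Gauss). [folklore] -/
theorem quinticPolyRat_irreducible : Irreducible quinticPolyRat :=
  quinticPoly_monic.irreducible_iff_irreducible_map_fraction_map.mp quinticPoly_irreducible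

/-- Irreducibility of `f` over `ℚ` as a `Fact`, so that `AdjoinRoot quinticPolyRat` is a field.
[folklore] -/
instance : Fact (Irreducible quinticPolyRat) := ⟨quinticPolyRat_irreducible⟩

/-- `f ≠ 0` in `ℚ[X]`. [folklore] -/
theorem quinticPolyRat_ne_zero : quinticPolyRat ≠ 0 := quinticPolyRat_irreducible.ne_zero

/-- `quinticPolyRat` is monic. [folklore] -/
theorem quinticPolyRat_monic : quinticPolyRat.Monic := quinticPoly_monic.map _

/-- `deg quinticPolyRat = 5`. [folklore] -/
theorem quinticPolyRat_natDegree : quinticPolyRat.natDegree = 5 := by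
  show (quinticPoly.map (algebraMap ℤ ℚ)).natDegree = 5
  rw [quinticPoly_monic.natDegree_map, quinticPoly_natDegree]

/-- `deg quinticPolyRat = 5` as a `degree`. [folklore] -/
theorem quinticPolyRat_degree : quinticPolyRat.degree = 5 := by
  rw [degree_eq_natDegree quinticPolyRat_ne_zero, quinticPolyRat_natDegree]; rfl

/-! ### The field `K = ℚ[X]/(f)` and its generator `θ` -/

/-- **The cyclic quintic field of conductor `241`**, `K = ℚ[X]/(f)`, `f` the period polynomial.
[folklore] -/
abbrev K : Type := AdjoinRoot quinticPolyRat

/-- `K` is a number field. [folklore] -/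
instance : NumberField K := by unfold K; infer_instance

/-- `θ ∈ K`, the class of `X` (the period `η₀ ≈ 9.72` under the standard real embedding). [folklore] -/
def θ : K := AdjoinRoot.root quinticPolyRat

/-- **The defining relation** `θ⁵ + θ⁴ - 96θ³ - 212θ² + 1232θ + 512 = 0`. [folklore] -/
theorem θ_rel : θ ^ 5 + θ ^ 4 - 96 * θ ^ 3 - 212 * θ ^ 2 + 1232 * θ + 512 = 0 := by
  have h : eval₂ (AdjoinRoot.of quinticPolyRat) (AdjoinRoot.root quinticPolyRat) quinticPolyRat = 0 :=
    AdjoinRoot.eval₂_root quinticPolyRat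
  rw [eval₂_map, quinticPoly] at h
  simp only [eval₂_add, eval₂_sub, eval₂_mul, eval₂_X_pow, eval₂_X, eval₂_ofNat, map_ofNat] at h
  exact h

/-- `θ⁵ = -θ⁴ + 96θ³ + 212θ² - 1232θ - 512`. [folklore] -/
theorem θ_pow_five : θ ^ 5 = -θ ^ 4 + 96 * θ ^ 3 + 212 * θ ^ 2 - 1232 * θ - 512 := by
  linear_combination θ_rel

/-- `θ` is a root of `f ∈ ℤ[X]`. [folklore] -/
theorem aeval_θ_quinticPoly : aeval θ quinticPoly = 0 := by
  rw [quinticPoly]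
  simp only [map_add, map_sub, map_pow, map_mul, aeval_X, map_ofNat]
  linear_combination θ_rel

/-- `θ` is a root of `f ∈ ℚ[X]`. [folklore] -/
theorem aeval_θ : aeval θ quinticPolyRat = 0 :=
  (aeval_map_algebraMap ℚ θ quinticPoly).trans aeval_θ_quinticPoly

/-- `θ` is an algebraic integer. [folklore] -/
theorem isIntegral_θ : IsIntegral ℤ θ := ⟨quinticPoly, quinticPoly_monic, aeval_θ_quinticPoly⟩

/-- `minpoly_ℤ θ = f`. [folklore] -/
theorem minpoly_int_θ : minpoly ℤ θ = quinticPoly :=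
  (eq_of_monic_of_associated (minpoly.monic isIntegral_θ) quinticPoly_monic
    ((minpoly.irreducible isIntegral_θ).associated_of_dvd quinticPoly_irreducible
      (minpoly.isIntegrallyClosed_dvd isIntegral_θ aeval_θ_quinticPoly)))

/-- `minpoly_ℚ θ = f`. [folklore] -/
theorem minpoly_rat_θ :
    minpoly ℚ θ = X ^ 5 + X ^ 4 - 96 * X ^ 3 - 212 * X ^ 2 + 1232 * X + 512 := by
  rw [minpoly.isIntegrallyClosed_eq_field_fractions' ℚ isIntegral_θ, minpoly_int_θ]
  exact quinticPolyRat_eq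

/-- The power basis `1, θ, …, θ⁴` of `K/ℚ`. [folklore] -/
def pbθ : PowerBasis ℚ K := AdjoinRoot.powerBasis quinticPolyRat_ne_zero

/-- The generator of `pbθ` is `θ`. [folklore] -/
theorem pbθ_gen : pbθ.gen = θ := AdjoinRoot.powerBasis_gen _

/-- `pbθ` has dimension `5`. [folklore] -/
theorem pbθ_dim : pbθ.dim = 5 := by
  rw [pbθ, AdjoinRoot.powerBasis_dim, quinticPolyRat_natDegree]

/-- **`[K : ℚ] = 5`.** [folklore] -/
theorem finrank_K : Module.finrank ℚ K = 5 := by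
  rw [← pbθ_dim, PowerBasis.finrank]

/-- `N_{K/ℚ}(θ) = -512 = -2⁹` (`= (-1)⁵ f(0)`). [folklore] -/
theorem norm_θ : Algebra.norm ℚ θ = -512 := by
  have h := Algebra.PowerBasis.norm_gen_eq_coeff_zero_minpoly pbθ
  rw [pbθ_gen, pbθ_dim, minpoly_rat_θ] at h
  rw [h]
  norm_num [coeff_X_pow, coeff_X, coeff_one]

/-- The class of a quartic `aX⁴ + bX³ + cX² + dX + e` is `aθ⁴ + bθ³ + cθ² + dθ + e`. [folklore] -/
theorem mk_quartic (a b c d e : ℚ) :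
    AdjoinRoot.mk quinticPolyRat (C a * X ^ 4 + C b * X ^ 3 + C c * X ^ 2 + C d * X + C e) =
      (a : K) * θ ^ 4 + (b : K) * θ ^ 3 + (c : K) * θ ^ 2 + (d : K) * θ + e := by
  simp only [map_add, map_mul, map_pow, AdjoinRoot.mk_C, AdjoinRoot.mk_X, eq_ratCast]
  rfl

/-- **A non-zero polynomial of degree `≤ 4` does not vanish at `θ`** (`f`, of degree `5`, is the
minimal polynomial). [folklore] -/
theorem quartic_ne_zero {a b c d e : ℚ} (h : (a, b, c, d, e) ≠ (0, 0, 0, 0, 0)) :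
    (a : K) * θ ^ 4 + (b : K) * θ ^ 3 + (c : K) * θ ^ 2 + (d : K) * θ + e ≠ 0 := by
  rw [← mk_quartic, Ne, AdjoinRoot.mk_eq_zero]
  intro hdvd
  have hq0 : (C a * X ^ 4 + C b * X ^ 3 + C c * X ^ 2 + C d * X + C e : ℚ[X]) ≠ 0 := by
    intro h0
    apply h
    have ha : a = 0 := by simpa using congrArg (coeff · 4) h0
    have hb : b = 0 := by simpa [ha] using congrArg (coeff · 3) h0
    have hc : c = 0 := by simpa [ha, hb] using congrArg (coeff · 2) h0
    have hd : d = 0 := by simpa [ha, hb, hc] using congrArg (coeff · 1) h0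
    have he : e = 0 := by simpa [ha, hb, hc, hd] using congrArg (coeff · 0) h0
    rw [ha, hb, hc, hd, he]
  have hdeg := degree_le_of_dvd hdvd hq0
  rw [quinticPolyRat_degree] at hdeg
  have h4 : (C a * X ^ 4 + C b * X ^ 3 + C c * X ^ 2 + C d * X + C e : ℚ[X]).degree ≤ 4 := by
    refine (degree_le_iff_coeff_zero _ _).mpr fun n hn => ?_
    have hn' : 4 < n := by exact_mod_cast hn
    simp only [coeff_add, coeff_C_mul, coeff_X_pow, coeff_X, coeff_C]
    rcases n with _ | _ | _ | _ | _ | n <;> simp_all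
  exact absurd (hdeg.trans h4) (by decide)

/-! ### The five periods `e241 k = P_k(θ)/176` and the period relations -/

/-- **The periods `η₀, …, η₄` inside `K = ℚ(η₀)`**: `ηₖ = Pₖ(η₀)/176` with
`P₁ = 736 + 400X - 318X² - 21X³ + 5X⁴`, `P₂ = -1392 - 636X + 204X² + 17X³ - 3X⁴`,
`P₃ = -992 + 668X + 112X² - 9X³ - X⁴`, `P₄ = 1472 - 608X + 2X² + 13X³ - X⁴` (and `P₀ = X`).
[folklore] -/
def e241 (k : Fin 5) : K :=
  match k with
  | 0 => θ
  | 1 => ((736 : K) + (400 : K) * θ + (-318 : K) * θ ^ 2 + (-21 : K) * θ ^ 3 + (5 : K) * θ ^ 4) / 176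
  | 2 => ((-1392 : K) + (-636 : K) * θ + (204 : K) * θ ^ 2 + (17 : K) * θ ^ 3 + (-3 : K) * θ ^ 4) / 176
  | 3 => ((-992 : K) + (668 : K) * θ + (112 : K) * θ ^ 2 + (-9 : K) * θ ^ 3 + (-1 : K) * θ ^ 4) / 176
  | 4 => ((1472 : K) + (-608 : K) * θ + (2 : K) * θ ^ 2 + (13 : K) * θ ^ 3 + (-1 : K) * θ ^ 4) / 176

/-- `e241 0 = θ`. [folklore] -/
@[simp] theorem e241_zero : e241 0 = θ := rfl

/-- **The periods form a period system in `K`**: the fifteen products `eᵢ eⱼ` are given by the table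
of cyclotomic numbers of order `5` for `p = 241`, and `Σ eₖ = -1` (polynomial identities modulo `f`).
[folklore] -/
theorem isPeriodSystem_e241 : PeriodRing241.IsPeriodSystem e241 where
  sum_eq := by
    simp only [e241]
    ring
  h00 := by
    simp only [e241]
    linear_combination (0 : K) * θ_rel
  h01 := by
    simp only [e241]
    linear_combination ((5/176 : K)) * θ_rel
  h02 := by
    simp only [e241]
    linear_combination ((-3/176 : K)) * θ_rel
  h03 := by
    simp only [e241]
    linear_combination ((-1/176 : K)) * θ_rel
  h04 := by
    simp only [e241]
    linear_combination ((-1/176 : K)) * θ_rel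
  h11 := by
    simp only [e241]
    linear_combination ((25/3872 : K) + (-13/3872 : K) * θ + (-235/30976 : K) * θ ^ 2 + (25/30976 : K) * θ ^ 3) * θ_rel
  h12 := by
    simp only [e241]
    linear_combination ((-101/1936 : K) + (7/15488 : K) * θ + (163/30976 : K) * θ ^ 2 + (-15/30976 : K) * θ ^ 3) * θ_rel
  h13 := by
    simp only [e241]
    linear_combination ((-5/3872 : K) + (303/15488 : K) * θ + (-19/30976 : K) * θ ^ 2 + (-5/30976 : K) * θ ^ 3) * θ_rel
  h14 := by
    simp only [e241]
    linear_combination ((9/484 : K) + (-129/7744 : K) * θ + (91/30976 : K) * θ ^ 2 + (-5/30976 : K) * θ ^ 3) * θ_rel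
  h22 := by
    simp only [e241]
    linear_combination ((491/7744 : K) + (5/3872 : K) * θ + (-111/30976 : K) * θ ^ 2 + (9/30976 : K) * θ ^ 3) * θ_rel
  h23 := by
    simp only [e241]
    linear_combination ((105/7744 : K) + (-103/7744 : K) * θ + (7/30976 : K) * θ ^ 2 + (3/30976 : K) * θ ^ 3) * θ_rel
  h24 := by
    simp only [e241]
    linear_combination ((-15/1936 : K) + (179/15488 : K) * θ + (-59/30976 : K) * θ ^ 2 + (3/30976 : K) * θ ^ 3) * θ_rel
  h33 := by
    simp only [e241]
    linear_combination ((-361/7744 : K) + (-1/484 : K) * θ + (17/30976 : K) * θ ^ 2 + (1/30976 : K) * θ ^ 3) * θ_rel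
  h34 := by
    simp only [e241]
    linear_combination ((155/3872 : K) + (-65/15488 : K) * θ + (-5/30976 : K) * θ ^ 2 + (1/30976 : K) * θ ^ 3) * θ_rel
  h44 := by
    simp only [e241]
    linear_combination ((-175/3872 : K) + (9/968 : K) * θ + (-27/30976 : K) * θ ^ 2 + (1/30976 : K) * θ ^ 3) * θ_rel

/-- **The realisation `PeriodRing241 ℤ →+* K`, `ηₖ ↦ e241 k`** (universal property of the order of
periods). [folklore] -/
def liftK : PeriodRing241 ℤ →+* K := PeriodRing241.lift isPeriodSystem_e241

/-- `liftK ηₖ = e241 k`. [folklore] -/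
@[simp] theorem liftK_eta (k : Fin 5) : liftK (PeriodRing241.eta k) = e241 k :=
  PeriodRing241.lift_eta isPeriodSystem_e241 k

/-! ### The automorphism `σ : e241 k ↦ e241 (k+1)`; `K/ℚ` is Galois -/

/-- **`f(η₁) = 0` in the order of periods** (by kernel computation). [folklore] -/
theorem eta_one_rel :
    (PeriodRing241.eta 1 : PeriodRing241 ℤ) ^ 5 + PeriodRing241.eta 1 ^ 4 - 96 * PeriodRing241.eta 1 ^ 3 -
      212 * PeriodRing241.eta 1 ^ 2 + 1232 * PeriodRing241.eta 1 + 512 = 0 := by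
  decide +kernel

/-- `e241 1` is a root of `f`. [folklore] -/
theorem aeval_e241_one : aeval (e241 1) quinticPolyRat = 0 := by
  refine (aeval_map_algebraMap ℚ _ quinticPoly).trans ?_
  rw [quinticPoly]
  simp only [map_add, map_sub, map_pow, map_mul, aeval_X, map_ofNat]
  have h := congrArg liftK eta_one_rel
  simp only [map_add, map_sub, map_mul, map_pow, map_ofNat, liftK_eta, map_zero] at h
  exact h

/-- `176 η_2 = P_1(η₁)` in the order of periods (by kernel computation). [folklore] -/
theorem shift_identity_1 :
    (176 : PeriodRing241 ℤ) * PeriodRing241.eta 2 = (736 : PeriodRing241 ℤ) + (400 : PeriodRing241 ℤ) * PeriodRing241.eta 1 + (-318 : PeriodRing241 ℤ) * PeriodRing241.eta 1 ^ 2 + (-21 : PeriodRing241 ℤ) * PeriodRing241.eta 1 ^ 3 + (5 : PeriodRing241 ℤ) * PeriodRing241.eta 1 ^ 4 := by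
  decide +kernel

/-- `176 η_3 = P_2(η₁)` in the order of periods (by kernel computation). [folklore] -/
theorem shift_identity_2 :
    (176 : PeriodRing241 ℤ) * PeriodRing241.eta 3 = (-1392 : PeriodRing241 ℤ) + (-636 : PeriodRing241 ℤ) * PeriodRing241.eta 1 + (204 : PeriodRing241 ℤ) * PeriodRing241.eta 1 ^ 2 + (17 : PeriodRing241 ℤ) * PeriodRing241.eta 1 ^ 3 + (-3 : PeriodRing241 ℤ) * PeriodRing241.eta 1 ^ 4 := by
  decide +kernel

/-- `176 η_4 = P_3(η₁)` in the order of periods (by kernel computation). [folklore] -/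
theorem shift_identity_3 :
    (176 : PeriodRing241 ℤ) * PeriodRing241.eta 4 = (-992 : PeriodRing241 ℤ) + (668 : PeriodRing241 ℤ) * PeriodRing241.eta 1 + (112 : PeriodRing241 ℤ) * PeriodRing241.eta 1 ^ 2 + (-9 : PeriodRing241 ℤ) * PeriodRing241.eta 1 ^ 3 + (-1 : PeriodRing241 ℤ) * PeriodRing241.eta 1 ^ 4 := by
  decide +kernel

/-- `176 η_0 = P_4(η₁)` in the order of periods (by kernel computation). [folklore] -/
theorem shift_identity_4 :
    (176 : PeriodRing241 ℤ) * PeriodRing241.eta 0 = (1472 : PeriodRing241 ℤ) + (-608 : PeriodRing241 ℤ) * PeriodRing241.eta 1 + (2 : PeriodRing241 ℤ) * PeriodRing241.eta 1 ^ 2 + (13 : PeriodRing241 ℤ) * PeriodRing241.eta 1 ^ 3 + (-1 : PeriodRing241 ℤ) * PeriodRing241.eta 1 ^ 4 := by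
  decide +kernel

/-- The `ℚ`-algebra endomorphism of `K` sending `θ ↦ e241 1`. [folklore] -/
def σHom : K →ₐ[ℚ] K :=
  AdjoinRoot.liftAlgHom quinticPolyRat (Algebra.ofId ℚ K) (e241 1) aeval_e241_one

/-- `σHom θ = e241 1`. [folklore] -/
theorem σHom_θ : σHom θ = e241 1 := AdjoinRoot.liftAlgHom_root _ _ _ _

/-- **The automorphism `σ` of `K/ℚ`**, `σ(θ) = e241 1` (bijective: injective endomorphism of a
finite-dimensional space). [folklore] -/
def σ : K ≃ₐ[ℚ] K :=
  AlgEquiv.ofBijective σHom ⟨(σHom : K →+* K).injective,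
    LinearMap.surjective_of_injective (f := σHom.toLinearMap) (σHom : K →+* K).injective⟩

/-- `σ θ = e241 1`. [folklore] -/
theorem σ_θ : σ θ = e241 1 := σHom_θ

/-- **`σ` shifts the periods: `σ (e241 k) = e241 (k + 1)`** (`σ(Pₖ(θ)/176) = Pₖ(η₁)/176 = ηₖ₊₁`, the
last step in the order of periods). [folklore] -/
theorem σ_e241 (k : Fin 5) : σ (e241 k) = e241 (k + 1) := by
  have key : ∀ (j : Fin 5) (P : PeriodRing241 ℤ), (176 : PeriodRing241 ℤ) * PeriodRing241.eta j = P →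
      (176 : K) * e241 j = liftK P := fun j P h => by
    have := congrArg liftK h
    simpa [map_mul, map_ofNat, liftK_eta] using this
  fin_cases k
  · exact σ_θ
  · have h := key 2 _ shift_identity_1
    simp only [map_add, map_mul, map_pow, map_ofNat, map_neg, liftK_eta] at h
    show σ (e241 1) = e241 2
    have e1 : σ (e241 1) = ((736 : K) + (400 : K) * e241 1 + (-318 : K) * e241 1 ^ 2 + (-21 : K) * e241 1 ^ 3 +
        (5 : K) * e241 1 ^ 4) / 176 := by
      simp only [e241, map_div₀, map_add, map_mul, map_pow, map_neg, map_ofNat, σ_θ]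
    rw [e1, div_eq_iff (by norm_num : (176 : K) ≠ 0)]
    linear_combination -h
  · have h := key 3 _ shift_identity_2
    simp only [map_add, map_mul, map_pow, map_ofNat, map_neg, liftK_eta] at h
    show σ (e241 2) = e241 3
    have e1 : σ (e241 2) = ((-1392 : K) + (-636 : K) * e241 1 + (204 : K) * e241 1 ^ 2 + (17 : K) * e241 1 ^ 3 +
        (-3 : K) * e241 1 ^ 4) / 176 := by
      simp only [e241, map_div₀, map_add, map_mul, map_pow, map_neg, map_ofNat, σ_θ]
    rw [e1, div_eq_iff (by norm_num : (176 : K) ≠ 0)]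
    linear_combination -h
  · have h := key 4 _ shift_identity_3
    simp only [map_add, map_mul, map_pow, map_ofNat, map_neg, map_one, liftK_eta] at h
    show σ (e241 3) = e241 4
    have e1 : σ (e241 3) = ((-992 : K) + (668 : K) * e241 1 + (112 : K) * e241 1 ^ 2 + (-9 : K) * e241 1 ^ 3 +
        (-1 : K) * e241 1 ^ 4) / 176 := by
      simp only [e241, map_div₀, map_add, map_mul, map_pow, map_neg, map_ofNat, map_one, σ_θ]
    rw [e1, div_eq_iff (by norm_num : (176 : K) ≠ 0)]
    linear_combination -h
  · have h := key 0 _ shift_identity_4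
    simp only [map_add, map_mul, map_pow, map_ofNat, map_neg, map_one, liftK_eta] at h
    show σ (e241 4) = e241 0
    have e1 : σ (e241 4) = ((1472 : K) + (-608 : K) * e241 1 + (2 : K) * e241 1 ^ 2 + (13 : K) * e241 1 ^ 3 +
        (-1 : K) * e241 1 ^ 4) / 176 := by
      simp only [e241, map_div₀, map_add, map_mul, map_pow, map_neg, map_ofNat, map_one, σ_θ]
    rw [e1, e241_zero, div_eq_iff (by norm_num : (176 : K) ≠ 0)]
    rw [e241_zero] at h
    linear_combination -h

/-- `σ` applied `k` times to `θ` gives the `k`-th period (`k < 5`). [folklore] -/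
theorem σ_iterate_θ (k : Fin 5) : σ^[(k : ℕ)] θ = e241 k := by
  fin_cases k
  · rfl
  · simpa using σ_θ
  · simp only [Fin.reduceFinMk, Function.iterate_succ_apply', Function.iterate_zero_apply, σ_θ, σ_e241]
    rfl
  · simp only [Fin.reduceFinMk, Function.iterate_succ_apply', Function.iterate_zero_apply, σ_θ, σ_e241]
    rfl
  · simp only [Fin.reduceFinMk, Function.iterate_succ_apply', Function.iterate_zero_apply, σ_θ, σ_e241]
    rfl

/-- `σ⁵ θ = θ`. [folklore] -/
theorem σ_iterate_five_θ : σ^[5] θ = θ := by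
  rw [Function.iterate_succ_apply', show (4 : ℕ) = ((4 : Fin 5) : ℕ) from rfl, σ_iterate_θ, σ_e241]
  rfl

/-- A `ℚ`-algebra automorphism of `K = ℚ(θ)` is determined by the image of `θ`. [folklore] -/
theorem algEquiv_eq_of_apply_θ {g h : K ≃ₐ[ℚ] K} (hgh : g θ = h θ) : g = h := by
  apply AlgEquiv.coe_toAlgHom_injective
  refine AdjoinRoot.algHom_ext ?_
  change g θ = h θ
  exact hgh

/-- `σ ^ n` applied to `x`, as an iterate. [folklore] -/
theorem σ_pow_apply (n : ℕ) (x : K) : (σ ^ n) x = σ^[n] x := by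
  induction n with
  | zero => rfl
  | succ n ih => rw [pow_succ', AlgEquiv.mul_apply, ih, Function.iterate_succ_apply']

/-- **`σ⁵ = 1`** in `Gal(K/ℚ)`. [folklore] -/
theorem σ_pow_five : σ ^ 5 = 1 :=
  algEquiv_eq_of_apply_θ (by rw [σ_pow_apply]; exact σ_iterate_five_θ)

/-- The periods `e241 k`, `k ≠ 0`, differ from `θ` (non-zero polynomials of degree `≤ 4` in `θ`).
[folklore] -/
theorem e241_ne_θ {k : Fin 5} (hk : k ≠ 0) : e241 k ≠ θ := by
  fin_cases k
  · exact absurd rfl hk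
  · intro h
    simp only [e241] at h
    rw [div_eq_iff (by norm_num : (176 : K) ≠ 0)] at h
    refine quartic_ne_zero (a := 5) (b := -21) (c := -318) (d := 400 - 176) (e := 736) (by norm_num) ?_
    push_cast; linear_combination h
  · intro h
    simp only [e241] at h
    rw [div_eq_iff (by norm_num : (176 : K) ≠ 0)] at h
    refine quartic_ne_zero (a := -3) (b := 17) (c := 204) (d := -636 - 176) (e := -1392) (by norm_num) ?_
    push_cast; linear_combination h
  · intro h
    simp only [e241] at h
    rw [div_eq_iff (by norm_num : (176 : K) ≠ 0)] at h
    refine quartic_ne_zero (a := -1) (b := -9) (c := 112) (d := 668 - 176) (e := -992) (by norm_num) ?_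
    push_cast; linear_combination h
  · intro h
    simp only [e241] at h
    rw [div_eq_iff (by norm_num : (176 : K) ≠ 0)] at h
    refine quartic_ne_zero (a := -1) (b := 13) (c := 2) (d := -608 - 176) (e := 1472) (by norm_num) ?_
    push_cast; linear_combination h

/-- `σᵏ ≠ 1` for `0 < k < 5`. [folklore] -/
theorem σ_pow_ne_one {k : ℕ} (hk0 : 0 < k) (hk5 : k < 5) : σ ^ k ≠ 1 := by
  intro h
  have e : (σ ^ k) θ = θ := by rw [h]; rfl
  rw [σ_pow_apply] at e
  interval_cases k
  · exact e241_ne_θ (k := 1) (by decide) ((σ_iterate_θ 1).symm.trans e)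
  · exact e241_ne_θ (k := 2) (by decide) ((σ_iterate_θ 2).symm.trans e)
  · exact e241_ne_θ (k := 3) (by decide) ((σ_iterate_θ 3).symm.trans e)
  · exact e241_ne_θ (k := 4) (by decide) ((σ_iterate_θ 4).symm.trans e)

/-- The powers `σ⁰, …, σ⁴` are pairwise distinct. [folklore] -/
theorem σ_pow_injective : Function.Injective fun i : Fin 5 => σ ^ (i : ℕ) := by
  intro i j hij
  simp only at hij
  rcases le_total (i : ℕ) j with h | h
  · have hji : σ ^ ((j : ℕ) - i) = 1 := by
      rw [← mul_left_inj (σ ^ (i : ℕ)), ← pow_add, Nat.sub_add_cancel h, one_mul]; exact hij.symm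
    by_contra hne
    exact σ_pow_ne_one (k := (j : ℕ) - i) (by omega) (by omega) hji
  · have hji : σ ^ ((i : ℕ) - j) = 1 := by
      rw [← mul_left_inj (σ ^ (j : ℕ)), ← pow_add, Nat.sub_add_cancel h, one_mul]; exact hij
    by_contra hne
    exact σ_pow_ne_one (k := (i : ℕ) - j) (by omega) (by omega) hji

/-- **`|Gal(K/ℚ)| = 5`.** [folklore] -/
theorem card_gal : Nat.card (K ≃ₐ[ℚ] K) = 5 := by
  classical
  rw [Nat.card_eq_fintype_card]
  refine le_antisymm (finrank_K ▸ AlgEquiv.card_le) ?_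
  simpa using Fintype.card_le_of_injective _ σ_pow_injective

/-- **`K/ℚ` is Galois** (cyclic of degree `5`). [folklore] -/
instance isGalois : IsGalois ℚ K :=
  IsGalois.of_card_aut_eq_finrank ℚ K (card_gal.trans finrank_K.symm)

/-- `i ↦ σⁱ` is a bijection `Fin 5 ≃ Gal(K/ℚ)`. [folklore] -/
theorem σ_pow_bijective : Function.Bijective fun i : Fin 5 => σ ^ (i : ℕ) := by
  classical
  refine (Fintype.bijective_iff_injective_and_card _).mpr ⟨σ_pow_injective, ?_⟩
  rw [Fintype.card_fin, ← Nat.card_eq_fintype_card, card_gal]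

/-- **`Gal(K/ℚ) = ⟨σ⟩`**: every automorphism is `σⁱ` for some `i < 5`. [folklore] -/
theorem gal_eq_pow (g : K ≃ₐ[ℚ] K) : ∃ i : Fin 5, g = σ ^ (i : ℕ) := by
  obtain ⟨i, hi⟩ := σ_pow_bijective.2 g
  exact ⟨i, hi.symm⟩

/-- **`N_{K/ℚ}(x) = ∏_{i<5} σⁱ(x)`.** [folklore] -/
theorem norm_eq_prod_pow_σ (x : K) :
    algebraMap ℚ K (Algebra.norm ℚ x) = ∏ i : Fin 5, (σ ^ (i : ℕ)) x := by
  classical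
  rw [Algebra.norm_eq_prod_automorphisms]
  exact (Fintype.prod_bijective _ σ_pow_bijective _ _ fun _ => rfl).symm

end CyclicQuintic241

end Literature.NumberTheory.NumberFields

end
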